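import Summits.QuantumAdvantage.QuantumAdvantage.Theses.MobiusLadder
import Summits.QuantumAdvantage.QuantumAdvantage.Theorems.MobiusLadderLiouvilleNotPPolyStubTransfer
import Summits.QuantumAdvantage.QuantumAdvantage.Theorems.MobiusLadderLiouvilleNotPPolyStubSqfreeSign
import Summits.QuantumAdvantage.QuantumAdvantage.Theorems.MobiusLadderLiouvilleNotPPolyStubSplitAtT
import Summits.QuantumAdvantage.QuantumAdvantage.Theorems.MobiusLadderLiouvilleNotPPolyStubMultAtShift
import Summits.QuantumAdvantage.QuantumAdvantage.Theorems.MobiusLadderLiouvilleNotPPolyStubAssemble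
import Literature.NumberTheory.EllipticCurves.RootNumberAtkinLehnerSemistableProofs
import Literature.NumberTheory.EllipticCurves.BSDRootNumberLocalTablesProofs

/-!
# Crux `MobiusLadder.LiouvilleNotPPoly` (stmt-QuantumAdvantage-1389): the ROOT-NUMBER TRANSFER

The conclusion of the line `SketchIdeator2` (idea `selmer-parity-transfer`; lead
`prover-line-stmt-QuantumAdvantage-1389-0`), assembled from its five landed stubs
(`stub_transfer`, `stub_sqfreeSign`, `stub_splitAtT`, `stub_multAtShift`, `stub_assemble`):

* `algebraicRootNumber_hesse_eq` — **Tate's algorithm on the `X₁(3)` family**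
  `E_t : y² + x·y + t·y = x³` (`t ≥ 1`): `E_t` is elliptic and SEMISTABLE (split multiplicative at
  `p ∣ t`, multiplicative at `p ∣ 27t − 1` and split iff `p ≡ 1 (mod 3)`, good elsewhere), with
  algebraic root number `−∏_p w_p(E_t) = −(−1)^{ω(t)} · (−1)^{ω₁(27t−1)}`
  (`ω₁(m) = #{p ∣ m : p ≡ 1 (mod 3)}`), UNCONDITIONALLY; on the squarefree locus
  (`t(27t−1)` squarefree) this is `λ(t) · λ(27t−1)` (`algebraicRootNumber_hesse_eq_liouville`);
* `rootNumber_hesse_eq_liouville` — the same for the ANALYTIC root number `w(E_t)` (the sign of the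
  functional equation of `L(E_t, s)`), CONDITIONAL on the Modularity Theorem, Version `L`
  (`Literature.NumberTheory.EllipticCurves.ModularForms.exists_isNewformOf`, named fact; for the
  semistable `E_t` this is Wiles 1995 / Taylor–Wiles 1995), through the tree's PROVED
  `rootNumber_eq_algebraicRootNumber_of_squarefree` (Kellock–Dokchitser 2023 Rem. 2.2 at `p ∥ N`,
  Atkin–Lehner at squarefree level);
* `liouvilleNotPPoly_of_rootSignHard` — **the crux `LiouvilleNotPPoly` BY NAME from the apex
  `RootSignHard`** ("no polynomial-size circuit family decides `w(E_t) = −1` from `bin t` on the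
  promise `t(27t−1)` squarefree"; hypothesis-type, the arithmetic avatar of `L_λ ∉ P/poly`) and the
  Modularity Theorem: a CONDITIONAL theorem on the route decl;
* `liouvilleNotPPoly_of_algRootSignHard` — the modularity-FREE variant with the algebraic root
  number as the apex (ONE hypothesis);
* `rootSign_mem_PPoly_of_not_liouvilleNotPPoly`, `algRootSign_mem_PPoly_of_not_liouvilleNotPPoly` —
  **the refutation floor**: any refutation of the crux yields polynomial-size circuits for the sign
  of the functional equation (resp. the product of local signs) of `E_t` on the promise, i.e. for
  the parity of the `3^∞`-Selmer corank (Dokchitser–Dokchitser) / of the Mordell–Weil rank (under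
  finiteness of Ш) of a semistable family — WITHOUT factoring the conductor.

Theorems only; the two hypotheses that remain are a published theorem (the Modularity Theorem,
named fact) and the explicit apex.
-/

set_option linter.dupNamespace false -- D-0017: single-problem summit ⇒ `QuantumAdvantage.QuantumAdvantage` by design

noncomputable section

namespace Summit.QuantumAdvantage.QuantumAdvantage.Theorems.LiouvilleNotPPoly

open scoped Classical
open _root_.Computability Literature.Computability.Complexity IsDedekindDomain
open Literature.NumberTheory.EllipticCurves.ModularForms (exists_isNewformOf)
open Summit.QuantumAdvantage.QuantumAdvantage.Theses.MobiusLadder (LiouvilleNotPPoly)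

/-! ### The root number of `E_t` -/

/-- **`E_t` (`t ≥ 1`) is elliptic, has no additive place, and has algebraic root number
`−(−1)^{ω(t)} (−1)^{ω₁(27t−1)}`** — stubs C1, C2 fed to F (Tate's algorithm on the family,
Rohrlich's local signs, the finite product). Unconditional. -/
theorem hesse_semistable_and_algebraicRootNumber {t : ℕ} (ht : 1 ≤ t) :
    ({ a₁ := 1, a₂ := 0, a₃ := (t : ℚ), a₄ := 0, a₆ := 0 } : WeierstrassCurve ℚ).IsElliptic ∧
    (∀ v : HeightOneSpectrum ℤ,
      ¬ ({ a₁ := 1, a₂ := 0, a₃ := (t : ℚ), a₄ := 0, a₆ := 0 } : WeierstrassCurve ℚ).HasAdditiveReductionAt v) ∧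
    ({ a₁ := 1, a₂ := 0, a₃ := (t : ℚ), a₄ := 0, a₆ := 0 } : WeierstrassCurve ℚ).algebraicRootNumber =
      -((-1 : ℤ) ^ ArithmeticFunction.cardDistinctFactors t) *
        (-1) ^ ((27 * t - 1).primeFactors.filter fun p => p % 3 = 1).card :=
  stub_assemble stub_splitAtT stub_multAtShift t ht

/-- **The algebraic root number of `E_t` on the squarefree locus is `λ(t) λ(27t−1)`** (with stub B:
`27t−1 ≡ 2 (mod 3)` has an odd number of prime factors `≡ 2 (mod 3)`). Unconditional. -/
theorem algebraicRootNumber_hesse_eq_liouville {t : ℕ} (ht : 1 ≤ t)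
    (hsq : Squarefree (t * (27 * t - 1))) :
    ({ a₁ := 1, a₂ := 0, a₃ := (t : ℚ), a₄ := 0, a₆ := 0 } : WeierstrassCurve ℚ).algebraicRootNumber =
      ArithmeticFunction.liouville t * ArithmeticFunction.liouville (27 * t - 1) :=
  (hesse_semistable_and_algebraicRootNumber ht).2.2.trans (stub_sqfreeSign t ht hsq)

/-- **`E_t` is semistable** (good or multiplicative reduction at every finite place). -/
theorem isSemistable_hesse {t : ℕ} (ht : 1 ≤ t) :
    ({ a₁ := 1, a₂ := 0, a₃ := (t : ℚ), a₄ := 0, a₆ := 0 } : WeierstrassCurve ℚ).IsSemistable ℤ :=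
  fun v => (WeierstrassCurve.isSemistableAt_iff_not_hasAdditiveReductionAt v _).mpr
    ((hesse_semistable_and_algebraicRootNumber ht).2.1 v)

/-- **`E_t` has squarefree conductor** (no additive place, and `p² ∣ N_E ↔`
additive reduction over `p`, the tree's PROVED `natGenerator_sq_dvd_conductorNorm_iff`). -/
theorem squarefree_conductorNorm_hesse {t : ℕ} (ht : 1 ≤ t) :
    Squarefree (({ a₁ := 1, a₂ := 0, a₃ := (t : ℚ), a₄ := 0, a₆ := 0 } : WeierstrassCurve ℚ).conductorNorm ℤ) := by
  haveI := (hesse_semistable_and_algebraicRootNumber ht).1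
  have hadd := (hesse_semistable_and_algebraicRootNumber ht).2.1
  refine Nat.squarefree_iff_prime_squarefree.2 fun p hp h => ?_
  set v : HeightOneSpectrum ℤ := (Rat.HeightOneSpectrum.primesEquiv (R := ℤ)).symm ⟨p, hp⟩ with hv
  have hgen : Rat.HeightOneSpectrum.natGenerator v = p :=
    congrArg Subtype.val ((Rat.HeightOneSpectrum.primesEquiv (R := ℤ)).apply_symm_apply ⟨p, hp⟩)
  refine hadd v ((Literature.NumberTheory.EllipticCurves.natGenerator_sq_dvd_conductorNorm_iff v _).mp ?_)
  rw [hgen, sq]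
  exact h

/-- **The analytic root number of `E_t`: `w(E_t) = −(−1)^{ω(t)} (−1)^{ω₁(27t−1)}`**, CONDITIONAL
on the Modularity Theorem, Version `L` (`exists_isNewformOf`): `E_t` is semistable, so the tree's
PROVED `rootNumber_eq_algebraicRootNumber_of_squarefree` applies. -/
theorem rootNumber_hesse_eq (hmod : exists_isNewformOf) {t : ℕ} (ht : 1 ≤ t) :
    ({ a₁ := 1, a₂ := 0, a₃ := (t : ℚ), a₄ := 0, a₆ := 0 } : WeierstrassCurve ℚ).rootNumber =
      -((-1 : ℤ) ^ ArithmeticFunction.cardDistinctFactors t) *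
        (-1) ^ ((27 * t - 1).primeFactors.filter fun p => p % 3 = 1).card := by
  obtain ⟨hell, hadd, halg⟩ := hesse_semistable_and_algebraicRootNumber ht
  haveI := hell
  have h := WeierstrassCurve.rootNumber_eq_algebraicRootNumber_of_squarefree _
    (squarefree_conductorNorm_hesse ht) hmod (fun v hv => absurd hv (hadd v))
  exact h.trans halg

/-- **`w(E_t) = λ(t) λ(27t−1)` on the squarefree locus** (`t ≥ 1`, `t(27t−1)` squarefree),
CONDITIONAL on the Modularity Theorem: the identity that makes the root number an arithmetic
avatar of the Liouville function. -/
theorem rootNumber_hesse_eq_liouville (hmod : exists_isNewformOf) {t : ℕ} (ht : 1 ≤ t)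
    (hsq : Squarefree (t * (27 * t - 1))) :
    ({ a₁ := 1, a₂ := 0, a₃ := (t : ℚ), a₄ := 0, a₆ := 0 } : WeierstrassCurve ℚ).rootNumber =
      ArithmeticFunction.liouville t * ArithmeticFunction.liouville (27 * t - 1) :=
  (rootNumber_hesse_eq hmod ht).trans (stub_sqfreeSign t ht hsq)

/-! ### The transfer -/

/-- `λ` on the squarefree promise vs the crux: a `P/poly` language for `L_λ` answers `λ N = −1`
correctly on every `N`, in particular on squarefree `N ≥ 1`. -/
theorem liouvilleNotPPoly_of_sqfHard
    (h : ¬ ∃ L ∈ PPoly, ∀ N : ℕ, 1 ≤ N → Squarefree N →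
      (encodeNat N ∈ L ↔ ArithmeticFunction.liouville N = -1)) :
    LiouvilleNotPPoly := by
  intro hmem
  apply h
  refine ⟨_, hmem, fun N _ _ => ?_⟩
  exact encodingNatBool.mem_toLanguage_iff {N : ℕ | ArithmeticFunction.liouville N = -1} N

/-- **The crux from the apex and the Modularity Theorem.** `RootSignHard` — "no polynomial-size
circuit family decides `w(E_t) = −1` from `bin t` on the promise `t(27t−1)` squarefree" (hypothesis-
type: the sign of the functional equation of `L(E_t, s)`, equivalently the parity of the
`3^∞`-Selmer corank of `E_t`, Dokchitser–Dokchitser 2010) — together with `exists_isNewformOf`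
gives `LiouvilleNotPPoly` BY NAME: a `P/poly` language for `λ` on squarefree inputs would, by the
two-query transfer `stub_transfer` and `w(E_t) = λ(t)λ(27t−1)`, decide the root sign on the
promise. CONDITIONAL theorem on the route decl. -/
theorem liouvilleNotPPoly_of_rootSignHard : Literature.NumberTheory.EllipticCurves.ModularForms.exists_isNewformOf → (¬ ∃ L ∈ Literature.Computability.Complexity.PPoly, ∀ t : ℕ, 1 ≤ t → Squarefree (t * (27 * t - 1)) → (Computability.encodeNat t ∈ L ↔ ({ a₁ := 1, a₂ := 0, a₃ := (t : ℚ), a₄ := 0, a₆ := 0 } : WeierstrassCurve ℚ).rootNumber = -1)) → Summit.QuantumAdvantage.QuantumAdvantage.Theses.MobiusLadder.LiouvilleNotPPoly :=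
  fun hmod hX => liouvilleNotPPoly_of_sqfHard fun hL => hX (stub_transfer
    (fun t => ({ a₁ := 1, a₂ := 0, a₃ := (t : ℚ), a₄ := 0, a₆ := 0 } : WeierstrassCurve ℚ).rootNumber)
    (fun _ ht hsq => rootNumber_hesse_eq_liouville hmod ht hsq) hL)

/-- **The crux from the algebraic apex alone (modularity-free).** If no polynomial-size circuit
family decides `−∏_p w_p(E_t) = −1` on the promise, then `LiouvilleNotPPoly`. ONE hypothesis. -/
theorem liouvilleNotPPoly_of_algRootSignHard
    (hX : ¬ ∃ L ∈ PPoly, ∀ t : ℕ, 1 ≤ t → Squarefree (t * (27 * t - 1)) →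
      (encodeNat t ∈ L ↔
        ({ a₁ := 1, a₂ := 0, a₃ := (t : ℚ), a₄ := 0, a₆ := 0 } : WeierstrassCurve ℚ).algebraicRootNumber = -1)) :
    LiouvilleNotPPoly :=
  liouvilleNotPPoly_of_sqfHard fun hL => hX (stub_transfer
    (fun t => ({ a₁ := 1, a₂ := 0, a₃ := (t : ℚ), a₄ := 0, a₆ := 0 } : WeierstrassCurve ℚ).algebraicRootNumber)
    (fun _ ht hsq => algebraicRootNumber_hesse_eq_liouville ht hsq) hL)

/-! ### The refutation floor -/

/-- **Refutation floor (analytic).** A refutation of the crux puts "the sign of the functional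
equation of `L(E_t, s)` is `−1`" (on the promise) in `P/poly`, given the Modularity Theorem. -/
theorem rootSign_mem_PPoly_of_not_liouvilleNotPPoly (hmod : exists_isNewformOf)
    (h : ¬ LiouvilleNotPPoly) :
    ∃ L ∈ PPoly, ∀ t : ℕ, 1 ≤ t → Squarefree (t * (27 * t - 1)) →
      (encodeNat t ∈ L ↔
        ({ a₁ := 1, a₂ := 0, a₃ := (t : ℚ), a₄ := 0, a₆ := 0 } : WeierstrassCurve ℚ).rootNumber = -1) := by
  by_contra hX
  exact h (liouvilleNotPPoly_of_rootSignHard hmod hX)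

/-- **Refutation floor (algebraic, unconditional).** A refutation of the crux puts "the product of
the local root numbers of `E_t` is `−1`" (on the promise) in `P/poly`. -/
theorem algRootSign_mem_PPoly_of_not_liouvilleNotPPoly (h : ¬ LiouvilleNotPPoly) :
    ∃ L ∈ PPoly, ∀ t : ℕ, 1 ≤ t → Squarefree (t * (27 * t - 1)) →
      (encodeNat t ∈ L ↔
        ({ a₁ := 1, a₂ := 0, a₃ := (t : ℚ), a₄ := 0, a₆ := 0 } : WeierstrassCurve ℚ).algebraicRootNumber = -1) := by
  by_contra hX
  exact h (liouvilleNotPPoly_of_algRootSignHard hX)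

end Summit.QuantumAdvantage.QuantumAdvantage.Theorems.LiouvilleNotPPoly

end
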